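import Mathlib.GroupTheory.OrderOfElement
import HarnessLib

/-!
# `x^p = 1` and `x^n = x` (`2 ≤ n ≤ p`) force `x = 1` (instrument, NOT a resolution theorem)

Engine 1 of the RESOLUTION OBSERVATORY toy model `W(f)` (CARVER-NOTES-eng1-g41 T97, typed ingredient (ii)): "an endomorphism `T` of an
elementary abelian `p`-group with `T^p = id` and `T = T^n` for some `2 ≤ n ≤ p − 1` is the identity".  This is a statement about ONE
element of a monoid (here: `T` in `AddMonoid.End A` / `Module.End`), and holds in any monoid: `x^n = x` and `x^p = 1` give
`x^{n−1} = 1` (multiply `x^{n−1}·x = x` by `x^{p−1}`), so the order of `x` divides `gcd(n − 1, p) = 1`.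
Pure group theory [Lang2002, Ch. I §4 (cyclic groups; the order of an element divides every exponent killing it)]; statements OURS
in this packaging.
-/

namespace Literature.AlgebraicGeometry.Resolution.WeightedBlowup

namespace PowerTorsion

variable {M : Type*} [Monoid M]

/-- `x^p = 1` (`p ≥ 1`) and `x^n = x` (`n ≥ 1`) give `x^{n−1} = 1` — in any monoid, no cancellation needed (ours).
[cite: Lang2002, Ch. I §4] -/
theorem pow_sub_one_eq_one {x : M} {p n : ℕ} (hp : 1 ≤ p) (hx : x ^ p = 1) (hn1 : 1 ≤ n) (hn : x ^ n = x) :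
    x ^ (n - 1) = 1 := by
  calc x ^ (n - 1) = x ^ (n - 1) * x ^ p := by rw [hx, mul_one]
    _ = x ^ n * x ^ (p - 1) := by
        rw [← pow_add, ← pow_add]
        congr 1
        omega
    _ = x ^ p := by rw [hn, ← pow_succ', Nat.sub_add_cancel hp]
    _ = 1 := hx

/-- **`x^p = 1`, `x^n = x`, `gcd(n − 1, p) = 1` ⇒ `x = 1`** (ours), in any monoid. [cite: Lang2002, Ch. I §4] -/
theorem eq_one_of_pow_eq_one_of_pow_eq_self {x : M} {p n : ℕ} (hp : 1 ≤ p) (hx : x ^ p = 1) (hn1 : 1 ≤ n) (hn : x ^ n = x)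
    (hcop : Nat.Coprime (n - 1) p) : x = 1 := by
  have h1 : orderOf x ∣ n - 1 := orderOf_dvd_of_pow_eq_one (pow_sub_one_eq_one hp hx hn1 hn)
  have h2 : orderOf x ∣ p := orderOf_dvd_of_pow_eq_one hx
  have h3 : orderOf x ∣ Nat.gcd (n - 1) p := Nat.dvd_gcd h1 h2
  rw [hcop.gcd_eq_one, Nat.dvd_one] at h3
  exact orderOf_eq_one_iff.mp h3

/-- **T97 (ii)** (ours): `p` prime, `x^p = 1` and `x^n = x` for some `2 ≤ n ≤ p` ⇒ `x = 1` (e.g. `x = T` an endomorphism of an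
elementary abelian `p`-group, in the monoid `AddMonoid.End A`). [cite: Lang2002, Ch. I §4] -/
theorem eq_one_of_pow_prime_eq_one_of_pow_eq_self {x : M} {p n : ℕ} (hp : p.Prime) (hx : x ^ p = 1) (hn : x ^ n = x)
    (h2 : 2 ≤ n) (hnp : n ≤ p) : x = 1 := by
  refine eq_one_of_pow_eq_one_of_pow_eq_self hp.one_lt.le hx (by omega) hn ?_
  refine ((Nat.Prime.coprime_iff_not_dvd hp).mpr fun h => ?_).symm
  exact Nat.not_dvd_of_pos_of_lt (by omega) (by omega) h

/-- The additive-endomorphism reading (ours): an endomorphism `T` of an additive group with `T^p = id` and `T^n = T`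
(`2 ≤ n ≤ p`, `p` prime) is the identity. [cite: Lang2002, Ch. I §4] -/
theorem addMonoidEnd_eq_one {A : Type*} [AddCommGroup A] {T : AddMonoid.End A} {p n : ℕ} (hp : p.Prime) (hT : T ^ p = 1)
    (hn : T ^ n = T) (h2 : 2 ≤ n) (hnp : n ≤ p) : T = 1 :=
  eq_one_of_pow_prime_eq_one_of_pow_eq_self hp hT hn h2 hnp

/-- Smoke test: in `ZMod 7`ˣ-free form — `x = 2 : ZMod 7` has `x^3 = 1` and `x^4 = x·x^3 = x`, but `gcd(4 − 1, 3) = 3 ≠ 1`, so the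
coprimality hypothesis is needed; with `p = 3`, `n = 2`: `x^2 = x ∧ x^3 = 1 ⇒ x = 1` is an instance. -/
example (x : ZMod 7) (h3 : x ^ 3 = 1) (h2 : x ^ 2 = x) : x = 1 :=
  eq_one_of_pow_prime_eq_one_of_pow_eq_self Nat.prime_three h3 h2 le_rfl (by decide)

end PowerTorsion

end Literature.AlgebraicGeometry.Resolution.WeightedBlowup
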